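import Summits.HodgeConjecture.HodgeConjecture.Theorems.EndoscopicMiddleDegreeOrthogonalEnvelopedHeckeHodgeType
import Summits.HodgeConjecture.HodgeConjecture.Theorems.EndoscopicMiddleDegreeOrthogonalEnvelopedHeckeRing
import Summits.HodgeConjecture.HodgeConjecture.Theorems.EndoscopicMiddleDegreeOrthogonalEnvelopedRationalBlocks
import Summits.HodgeConjecture.HodgeConjecture.Theorems.EndoscopicMiddleDegreeOrthogonalEnvelopedKilledBarren
import Summits.HodgeConjecture.HodgeConjecture.Theorems.EndoscopicMiddleDegreeMiddleThetaSpanHeckeIdempotents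
import Literature.AlgebraicGeometry.HodgeTheory.HodgeTypeConjugation

/-!
# `OrthogonalEnveloped` from THE BET ALONE
# (crux `EndoscopicMiddleDegree.OrthogonalEnveloped`, stmt-HodgeConjecture-14300, line `purity-sorted-hecke-envelope`, lead seat c6)

The registered skeleton of the line (rev c6-L2, `Cruxes/OrthogonalEnveloped/Lines/purity_sorted_hecke_envelope.lean`) made
durable: its ONLY remaining stub, the bet `stub_coreVanishing` (wide cores carry no rational `(n,n)`-class; HC-strength by
the standing disproof F1/F5), is turned into the hypothesis `hCore` (VERBATIM the registered signature), and
`OrthogonalEnveloped` follows — with NO named fact and NO other route item: Grothendieck's coniveau remark is replaced by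
the analytic Hodge-type stability of the Hecke algebra (`heckeHodgeType`, `…HeckeHodgeType.lean`), and
`CupProductAlgebraic` by the Hecke ring (`adjoin_hecke_le_span`, `…HeckeRing.lean`). Compare the earlier durable form
`EndoscopicMiddleDegreeOrthogonalEnvelopedOfCoreVanishing.orthogonalEnveloped_of_coreVanishing` (seat c5, p115730:
`Grothendieck1969 → CupProductAlgebraic → bet → crux`). References: BMM arXiv:1306.1515 Part 2 §1.8–1.9, Thm. 61;
Shimura 1971 §3.1, §8.3; Arancibia–Moeglin–Renard arXiv:1507.01432 §8.
-/

noncomputable section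

-- The crux-workfile namespace `Summit.<P>.<Sub>.Cruxes.…` repeats `HodgeConjecture` (single-conjunct summit).
set_option linter.dupNamespace false

namespace Summit.HodgeConjecture.HodgeConjecture.Cruxes.OrthogonalEnveloped.PuritySortedHeckeEnvelope

open scoped BigOperators
open CategoryTheory MonoidalCategory CartesianMonoidalCategory
open Literature.AlgebraicGeometry.Motives (SchemeOver ComplexPoints IsSmoothProjective)
open Literature.AlgebraicGeometry.HodgeTheory
open Literature.AlgebraicGeometry.ShimuraVarieties
open Literature.AlgebraicTopology.SingularHomology
open Summit.HodgeConjecture.HodgeConjecture.Theses.EndoscopicMiddleDegree (OrthogonalEnveloped)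
open Summit.HodgeConjecture.HodgeConjecture.Cruxes.MiddleThetaSpan.ConjugateDimensionSieve
  (IsCentralIdempotent IsPrimitiveCentralIdempotent exists_primitiveCentralIdempotents conjAct)
open Summit.HodgeConjecture.HodgeConjecture.Cruxes.OrthogonalEnveloped.ImpureBarrenEnvelope
  (stub_rationalBlocks)
open Summit.HodgeConjecture.HodgeConjecture.Cruxes.OrthogonalEnveloped.HeckeGraphChow
  (heckeGraphAlgebraic)

/-- **`OrthogonalEnveloped` GRANTED THE BET ALONE.** The hypothesis `hCore` is VERBATIM the registered stub
`stub_coreVanishing` of the line (an impure, un-killed ℚ-block of the Hecke algebra — a wide core, Disproof F5b — kills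
every rational `(n,n)`-class `e ⊥ TW(D)`). With the ℚ-blocks `ε` of the Hecke algebra (`stub_rationalBlocks`, p87916),
each the action of an ALGEBRAIC class (the Hecke algebra is the span of the `T_g`, `adjoin_hecke_le_span`, and each `T_g`
is the action of an algebraic class, `heckeGraphAlgebraic` p111880), the envelope of `e` is `γ := Σ_{ε pure} γ_ε`: its
action preserves rational classes, is `(n,n)`-valued, and fixes `e` because `Σ ε = 1` and every impure block kills `e` —
a killed one by the coefficient-conjugation sieve (`stub_killedBarren` p96373, fed the UNCONDITIONAL `heckeHodgeType`), an
un-killed one by `hCore`. [cite: BergeronMillsonMoeglin2016Balls, Part 2 §1.9 and Thm. 61] [cite: ArancibiaMoeglinRenard2015, §8] -/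
theorem orthogonalEnveloped_of_bet :
    (∀ (m : ℕ) (X : SchemeOver ℂ) (D : UnitaryBallQuotientDatum (2 * (m + 1)) X), 1 ≤ m → m ≤ 2 →
      ∀ ε : Module.End ℂ (complexBetti X (2 * (m + 1))),
        ε ∈ Algebra.adjoin ℂ (Set.range (D.heckeCorrespondenceAction (2 * (m + 1)))) →
        ε * ε = ε →
        (∀ T ∈ Algebra.adjoin ℂ (Set.range (D.heckeCorrespondenceAction (2 * (m + 1)))),
          T * ε = ε * T) →
        (∀ β, IsRationalClass β → IsRationalClass (ε β)) →
        (∀ f ∈ Algebra.adjoin ℂ (Set.range (D.heckeCorrespondenceAction (2 * (m + 1)))),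
          f * f = f →
          (∀ T ∈ Algebra.adjoin ℂ (Set.range (D.heckeCorrespondenceAction (2 * (m + 1)))),
            T * f = f * T) →
          (∀ β, IsRationalClass β → IsRationalClass (f β)) → f * ε = 0 ∨ f * ε = ε) →
        (∃ β, ¬ IsOfHodgeType (2 * (m + 1)) X (2 * (m + 1)) (m + 1) (m + 1) (ε β)) →
        (∃ z : Module.End ℂ (complexBetti X (2 * (m + 1))),
          IsPrimitiveCentralIdempotent
              (Algebra.adjoin ℂ (Set.range (D.heckeCorrespondenceAction (2 * (m + 1))))) z ∧
            z * ε = z ∧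
              ∀ σ : ℂ ≃+* ℂ, ∃ c : complexBetti X (2 * (m + 1)),
                IsOfHodgeType (2 * (m + 1)) X (2 * (m + 1)) (m + 1) (m + 1) (conjEnd σ z c) ∧
                  conjEnd σ z c ≠ 0) →
        ∀ e : complexBetti X (2 * (m + 1)), IsRationalClass e →
          IsOfHodgeType (2 * (m + 1)) X (2 * (m + 1)) (m + 1) (m + 1) e →
          (∀ x ∈ ((⨆ (W : Submodule D.E (Fin (2 * (m + 1) + 1) → D.E))
              (_ : IsTotallyPositive (conjRingHom D.E) D.H W) (_ : Module.finrank D.E W = m + 1),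
              classesSupportedOn X (D.specialSubvariety W) (2 * (m + 1))) ⊔
            (⨆ (W : Submodule D.E (Fin (2 * (m + 1) + 1) → D.E))
              (_ : IsTotallyPositive (conjRingHom D.E) D.H W) (_ : Module.finrank D.E W = m)
              (Z : Set X.left) (_ : IsClosed Z) (_ : Z ⊆ D.specialSubvariety W)
              (_ : ∀ z ∈ Z, ((m + 1 : ℕ) : ℕ∞) ≤ Order.coheight z),
              classesSupportedOn X Z (2 * (m + 1))) ⊔
            Submodule.span ℂ {z : complexBetti X (2 * (m + 1)) |
              ∃ a : complexBetti X (2 * m), IsRationalClass a ∧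
                IsOfHodgeType (2 * (m + 1)) X (2 * m) m m a ∧
                ∃ d ∈ algebraicClasses X 1,
                  z = cupProduct (two_mul_add_two_mul m 1) a d}),
            cupProduct (two_mul_add_two_mul (m + 1) (m + 1)) e x = 0) →
          ε e = 0) →
    OrthogonalEnveloped := by
  intro hCore μ hμ m X D hm1 hm2 e he hH horth
  classical
  -- the ℚ-blocks of the Hecke algebra
  obtain ⟨s, hblk, -, hsum⟩ := stub_rationalBlocks m X D hm1 hm2
  -- every element of the Hecke algebra is the action of an ALGEBRAIC class: the Hecke algebra is the span of
  -- the `T_g` (`adjoin_hecke_le_span`, from the Hecke ring `heckeMul_mem_span`), each `T_g` is the action of an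
  -- algebraic class (`heckeGraphAlgebraic`, landed p111880), and `γ ↦ P_γ` is linear
  have halg : ∀ a ∈ Algebra.adjoin ℂ (Set.range (D.heckeCorrespondenceAction (2 * (m + 1)))),
      ∃ γ ∈ algebraicClasses (X ⊗ X) (2 * (m + 1)),
        corrAction μ D.isSmoothProjective D.isSmoothProjective
          (rfl : 2 * (m + 1) + 2 * (2 * (m + 1)) = 2 * (m + 1) + 2 * (2 * (m + 1))) γ = a := by
    intro a ha
    have ha' := adjoin_hecke_le_span D _ ha
    clear ha
    induction ha' using Submodule.span_induction with
    | mem T hT =>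
      obtain ⟨g, rfl⟩ := hT
      exact heckeGraphAlgebraic μ hμ m X D hm1 hm2 g
    | zero => exact ⟨0, zero_mem _, map_zero _⟩
    | add a b _ _ iha ihb =>
      obtain ⟨γ, hγ, rfl⟩ := iha
      obtain ⟨γ', hγ', rfl⟩ := ihb
      exact ⟨γ + γ', add_mem hγ hγ', map_add _ _ _⟩
    | smul c a _ iha =>
      obtain ⟨γ, hγ, rfl⟩ := iha
      exact ⟨c • γ, Submodule.smul_mem _ c hγ, map_smul _ _ _⟩
  -- the Hecke algebra preserves the Hodge type `(n,n)` (`heckeHodgeType`, from Stubs L1–L5)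
  have hHodge : ∀ a ∈ Algebra.adjoin ℂ (Set.range (D.heckeCorrespondenceAction (2 * (m + 1)))),
      ∀ c : complexBetti X (2 * (m + 1)),
        IsOfHodgeType (2 * (m + 1)) X (2 * (m + 1)) (m + 1) (m + 1) c →
          IsOfHodgeType (2 * (m + 1)) X (2 * (m + 1)) (m + 1) (m + 1) (a c) :=
    fun a ha ↦ heckeHodgeType D ha
  -- each block is the action of an algebraic class
  have hεS : ∀ ε ∈ s, ∃ γ ∈ algebraicClasses (X ⊗ X) (2 * (m + 1)),
      corrAction μ D.isSmoothProjective D.isSmoothProjective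
        (rfl : 2 * (m + 1) + 2 * (2 * (m + 1)) = 2 * (m + 1) + 2 * (2 * (m + 1))) γ = ε :=
    fun ε hε ↦ halg ε (hblk ε hε).1
  choose! γf hγf hPγ using hεS
  -- the pure blocks and the envelope
  let pure : Module.End ℂ (complexBetti X (2 * (m + 1))) → Prop :=
    fun ε ↦ ∀ β, IsOfHodgeType (2 * (m + 1)) X (2 * (m + 1)) (m + 1) (m + 1) (ε β)
  have hP : corrAction μ D.isSmoothProjective D.isSmoothProjective
      (rfl : 2 * (m + 1) + 2 * (2 * (m + 1)) = 2 * (m + 1) + 2 * (2 * (m + 1)))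
      (∑ ε ∈ s.filter pure, γf ε) = ∑ ε ∈ s.filter pure, ε := by
    rw [map_sum]
    exact Finset.sum_congr rfl fun ε hε ↦ hPγ ε (Finset.mem_filter.1 hε).1
  refine ⟨∑ ε ∈ s.filter pure, γf ε,
    Submodule.sum_mem _ fun ε hε ↦ hγf ε (Finset.mem_filter.1 hε).1, ?_⟩
  intro P
  have hPβ : ∀ β, P β = ∑ ε ∈ s.filter pure, ε β := fun β ↦ by
    change corrAction μ D.isSmoothProjective D.isSmoothProjective
      (rfl : 2 * (m + 1) + 2 * (2 * (m + 1)) = 2 * (m + 1) + 2 * (2 * (m + 1)))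
      (∑ ε ∈ s.filter pure, γf ε) β = _
    rw [hP, LinearMap.sum_apply]
  obtain ⟨A, -⟩ := id hH
  refine ⟨fun β hβ ↦ ?_, fun β ↦ ?_, ?_⟩
  · -- rational classes are preserved: each ℚ-block preserves them
    rw [hPβ]
    exact Finset.sum_induction _ (fun x ↦ IsRationalClass x) (fun a b ha hb ↦ ha.add hb)
      IsRationalClass.zero (fun ε hε ↦ (hblk ε (Finset.mem_filter.1 hε).1).2.2.2.1 β hβ)
  · -- the image is purely `(n,n)`: a sum of `(n,n)`-classes (pure blocks, by definition)
    rw [hPβ]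
    exact IsOfHodgeType.sum D.isSmoothProjective A _ _ fun ε hε ↦ (Finset.mem_filter.1 hε).2 β
  · -- `e` is fixed: `e = Σ_ε ε e`, and every impure block — killed or core — kills `e`
    rw [hPβ]
    have he_sum : e = ∑ ε ∈ s, ε e := by
      conv_lhs => rw [show e = (∑ ε ∈ s, ε) e by rw [hsum]; rfl]
      rw [LinearMap.sum_apply]
    have hzero : ∑ ε ∈ s.filter (fun ε ↦ ¬ pure ε), ε e = 0 := by
      refine Finset.sum_eq_zero fun ε hε ↦ ?_
      obtain ⟨hεs, hnp⟩ := Finset.mem_filter.1 hε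
      obtain ⟨h1, h2, h3, h4, h5⟩ := hblk ε hεs
      by_cases hK : ∀ z : Module.End ℂ (complexBetti X (2 * (m + 1))),
          IsPrimitiveCentralIdempotent
              (Algebra.adjoin ℂ (Set.range (D.heckeCorrespondenceAction (2 * (m + 1))))) z →
            z * ε = z →
              ∃ σ : ℂ ≃+* ℂ, ∀ c : complexBetti X (2 * (m + 1)),
                IsOfHodgeType (2 * (m + 1)) X (2 * (m + 1)) (m + 1) (m + 1) (conjEnd σ z c) →
                  conjEnd σ z c = 0
      · -- (K) a KILLED block: barren by the sieve
        exact stub_killedBarren m X D hm1 hm2 hHodge ε h1 h2 h3 hK e he hH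
      · -- (C) a CORE: barren by the bet
        push Not at hK
        exact hCore m X D hm1 hm2 ε h1 h2 h3 h4 h5 (not_forall.1 hnp) hK e he hH horth
    conv_rhs => rw [he_sum, ← Finset.sum_filter_add_sum_filter_not s pure]
    rw [hzero, add_zero]

/-- **The bet implies NoImpureRationalComponents — UNCONDITIONALLY** (cf. seat c5's
`EndoscopicMiddleDegreeOrthogonalEnvelopedOfCoreVanishing.impureBlocksBarren_of_coreVanishing`, which needed
Grothendieck's coniveau remark): an impure ℚ-block `ε` of the Hecke algebra kills every rational `(n,n)`-class
`e ⊥ TW(D)` — a KILLED one by the coefficient-conjugation sieve (`stub_killedBarren` p96373, fed the unconditional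
`heckeHodgeType` p118087), an un-killed one (a wide core) by the bet `hCore` (VERBATIM the registered stub
`stub_coreVanishing`). The converse is trivial, so the registered bet and NoImpureRationalComponents (the conclusion, =
hypothesis `hKill` of `orthogonalEnveloped_of_impureBlocksBarren`, p115730) are EQUIVALENT with no named fact.
[cite: BergeronMillsonMoeglin2016Balls, Part 2 §1.9] [cite: ArancibiaMoeglinRenard2015, §8] -/
theorem impureBlocksBarren_of_bet
    (hCore :
    ∀ (m : ℕ) (X : SchemeOver ℂ) (D : UnitaryBallQuotientDatum (2 * (m + 1)) X), 1 ≤ m → m ≤ 2 →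
      ∀ ε : Module.End ℂ (complexBetti X (2 * (m + 1))),
        ε ∈ Algebra.adjoin ℂ (Set.range (D.heckeCorrespondenceAction (2 * (m + 1)))) →
        ε * ε = ε →
        (∀ T ∈ Algebra.adjoin ℂ (Set.range (D.heckeCorrespondenceAction (2 * (m + 1)))),
          T * ε = ε * T) →
        (∀ β, IsRationalClass β → IsRationalClass (ε β)) →
        (∀ f ∈ Algebra.adjoin ℂ (Set.range (D.heckeCorrespondenceAction (2 * (m + 1)))),
          f * f = f →
          (∀ T ∈ Algebra.adjoin ℂ (Set.range (D.heckeCorrespondenceAction (2 * (m + 1)))),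
            T * f = f * T) →
          (∀ β, IsRationalClass β → IsRationalClass (f β)) → f * ε = 0 ∨ f * ε = ε) →
        (∃ β, ¬ IsOfHodgeType (2 * (m + 1)) X (2 * (m + 1)) (m + 1) (m + 1) (ε β)) →
        (∃ z : Module.End ℂ (complexBetti X (2 * (m + 1))),
          IsPrimitiveCentralIdempotent
              (Algebra.adjoin ℂ (Set.range (D.heckeCorrespondenceAction (2 * (m + 1))))) z ∧
            z * ε = z ∧
              ∀ σ : ℂ ≃+* ℂ, ∃ c : complexBetti X (2 * (m + 1)),
                IsOfHodgeType (2 * (m + 1)) X (2 * (m + 1)) (m + 1) (m + 1) (conjEnd σ z c) ∧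
                  conjEnd σ z c ≠ 0) →
        ∀ e : complexBetti X (2 * (m + 1)), IsRationalClass e →
          IsOfHodgeType (2 * (m + 1)) X (2 * (m + 1)) (m + 1) (m + 1) e →
          (∀ x ∈ ((⨆ (W : Submodule D.E (Fin (2 * (m + 1) + 1) → D.E))
              (_ : IsTotallyPositive (conjRingHom D.E) D.H W) (_ : Module.finrank D.E W = m + 1),
              classesSupportedOn X (D.specialSubvariety W) (2 * (m + 1))) ⊔
            (⨆ (W : Submodule D.E (Fin (2 * (m + 1) + 1) → D.E))
              (_ : IsTotallyPositive (conjRingHom D.E) D.H W) (_ : Module.finrank D.E W = m)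
              (Z : Set X.left) (_ : IsClosed Z) (_ : Z ⊆ D.specialSubvariety W)
              (_ : ∀ z ∈ Z, ((m + 1 : ℕ) : ℕ∞) ≤ Order.coheight z),
              classesSupportedOn X Z (2 * (m + 1))) ⊔
            Submodule.span ℂ {z : complexBetti X (2 * (m + 1)) |
              ∃ a : complexBetti X (2 * m), IsRationalClass a ∧
                IsOfHodgeType (2 * (m + 1)) X (2 * m) m m a ∧
                ∃ d ∈ algebraicClasses X 1,
                  z = cupProduct (two_mul_add_two_mul m 1) a d}),
            cupProduct (two_mul_add_two_mul (m + 1) (m + 1)) e x = 0) →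
          ε e = 0) :
    ∀ (m : ℕ) (X : SchemeOver ℂ) (D : UnitaryBallQuotientDatum (2 * (m + 1)) X), 1 ≤ m → m ≤ 2 →
      ∀ ε : Module.End ℂ (complexBetti X (2 * (m + 1))),
        ε ∈ Algebra.adjoin ℂ (Set.range (D.heckeCorrespondenceAction (2 * (m + 1)))) →
        ε * ε = ε →
        (∀ T ∈ Algebra.adjoin ℂ (Set.range (D.heckeCorrespondenceAction (2 * (m + 1)))),
          T * ε = ε * T) →
        (∀ β, IsRationalClass β → IsRationalClass (ε β)) →
        (∀ f ∈ Algebra.adjoin ℂ (Set.range (D.heckeCorrespondenceAction (2 * (m + 1)))),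
          f * f = f →
          (∀ T ∈ Algebra.adjoin ℂ (Set.range (D.heckeCorrespondenceAction (2 * (m + 1)))),
            T * f = f * T) →
          (∀ β, IsRationalClass β → IsRationalClass (f β)) → f * ε = 0 ∨ f * ε = ε) →
        (∃ β, ¬ IsOfHodgeType (2 * (m + 1)) X (2 * (m + 1)) (m + 1) (m + 1) (ε β)) →
        ∀ e : complexBetti X (2 * (m + 1)), IsRationalClass e →
          IsOfHodgeType (2 * (m + 1)) X (2 * (m + 1)) (m + 1) (m + 1) e →
          (∀ x ∈ ((⨆ (W : Submodule D.E (Fin (2 * (m + 1) + 1) → D.E))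
              (_ : IsTotallyPositive (conjRingHom D.E) D.H W) (_ : Module.finrank D.E W = m + 1),
              classesSupportedOn X (D.specialSubvariety W) (2 * (m + 1))) ⊔
            (⨆ (W : Submodule D.E (Fin (2 * (m + 1) + 1) → D.E))
              (_ : IsTotallyPositive (conjRingHom D.E) D.H W) (_ : Module.finrank D.E W = m)
              (Z : Set X.left) (_ : IsClosed Z) (_ : Z ⊆ D.specialSubvariety W)
              (_ : ∀ z ∈ Z, ((m + 1 : ℕ) : ℕ∞) ≤ Order.coheight z),
              classesSupportedOn X Z (2 * (m + 1))) ⊔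
            Submodule.span ℂ {z : complexBetti X (2 * (m + 1)) |
              ∃ a : complexBetti X (2 * m), IsRationalClass a ∧
                IsOfHodgeType (2 * (m + 1)) X (2 * m) m m a ∧
                ∃ d ∈ algebraicClasses X 1,
                  z = cupProduct (two_mul_add_two_mul m 1) a d}),
            cupProduct (two_mul_add_two_mul (m + 1) (m + 1)) e x = 0) →
          ε e = 0 := by
  intro m X D hm1 hm2 ε h1 h2 h3 h4 h5 himp e he hH horth
  by_cases hK : ∀ z : Module.End ℂ (complexBetti X (2 * (m + 1))),
      IsPrimitiveCentralIdempotent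
          (Algebra.adjoin ℂ (Set.range (D.heckeCorrespondenceAction (2 * (m + 1))))) z →
        z * ε = z →
          ∃ σ : ℂ ≃+* ℂ, ∀ c : complexBetti X (2 * (m + 1)),
            IsOfHodgeType (2 * (m + 1)) X (2 * (m + 1)) (m + 1) (m + 1) (conjEnd σ z c) →
              conjEnd σ z c = 0
  · -- (K) a KILLED block: barren by the sieve
    exact stub_killedBarren m X D hm1 hm2 (fun a ha ↦ heckeHodgeType D ha) ε h1 h2 h3 hK
      e he hH
  · -- (C) a wide CORE: barren by the bet
    push Not at hK
    exact hCore m X D hm1 hm2 ε h1 h2 h3 h4 h5 himp hK e he hH horth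

end Summit.HodgeConjecture.HodgeConjecture.Cruxes.OrthogonalEnveloped.PuritySortedHeckeEnvelope

end
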